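/-
Copyright: the b2b-balaban T⁴-continuum CRUX team, row NE7b OWNER lineage `t4-ne7b-p1` (gen 141). Project licence.
-/
import Summits.QuantumFields.BalabanUV.T4Continuum.Spine.NE7b.SupFourthCumulantCutBounds
import Summits.QuantumFields.BalabanUV.T4Continuum.Spine.NE7b.SupFourPointCutTree

/-!
# THE FOURTH CUMULANT ACROSS THE THREE PAIR CUTS (SCOPING (d13)(2), seventh file).  For four class observables under (447)'s Gibbs law with
# decaying Dobrushin forms `B(a_i,a_j) ≤ K∕r_{ij}²⁴` (`r_{ij} ≥ 1`) and centred moments `≤ M₂, M₄, M₆`, the fourth cumulant of the centred observables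
#   `u₄ = E[f₁f₂f₃f₄] − E[f₁f₂]E[f₃f₄] − E[f₁f₃]E[f₂f₄] − E[f₁f₄]E[f₂f₃]`   (`f_i = F_i − E_νF_i`)
# satisfies `|u₄| ≤ C·(max_{crossing} q)³`, `q_{ij} = r_{ij}⁻²`, `C = 4K + 3K² + 4M₄ + 4M₆ + 2M₂(M₂+M₄)`, for the cuts `{1,2}|{3,4}`, `{1,3}|{2,4}`,
# `{1,4}|{2,3}` ((491)'s pair-cut bound relabelled, plus the two crossing pairings `≤ K²∕r_min⁶` each) — three of (487)'s seven hypotheses; the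
# four single cuts are the next file (row NE7b, node U5c; (491), (487) BY NAME; [folklore])

Cell `pub-balaban`, sub-cell `t4`, spine estimate NE7b (`T4WeightBudget.RelWeightBound`; the cell's OWN estimate — NOT PRINTED in
[Bałaban 1983–89], NOT PROVED).  Crux-route work under `Spine/NE7b/` by the row OWNER (`t4-ne7b-p1` gen 141, file (492)) under FREEZE
(0)'s crux-prover clause; NOTHING of Bałaban's is named as a Lean object, valued or asserted; no `T4Continuum/Support` leaf typed; no
`def`, no notation (`u₄` WRITTEN OUT); zero `sorry`.  Imports (BY NAME): the OWNER's (491) `…SupFourthCumulantCutBounds` (`pair_cut_bound`, `pairing_abs_le`, `decay_le_min_pow`), (487) `…SupFourPointCutTree` (`abs_u4_le_pair_cut`).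

WHAT IS PROVED ([folklore]): §1 bookkeeping (`bilinear_symm`, `pairing_prod_le`, `pairing_prod_le'`, `inv_min3_sq_le`, `inv_min4_sq_le`, `div_pow_six_le`); §2 **`cut_one_two`** (the other two pair cuts: next file).

HONEST (what this is NOT).  The abstract Gibbs-format statement; the whitened instantiation (`F_v = U′(Aξ+ψ)[e_v]`, `B ≤ K∕r²⁴` from (466) with
`r²⁴ ≤ σσ`, `M₂, M₄` from (464)∕(465)), the sixth-moment letter `M₆` (NOT discharged — (423)'s Gaussian moments to `|φ|¹²` needed), the site-indexed
row letter via (488), and the cumulant FORM of `∂⁴W` with its assembly are the successor's; scalar skeleton ((A3), NC-NE7b-α UNRULED); nothing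
of Bałaban's asserted.  BY-NAME EFFECT ON THE WALL: NONE.  NE7b NOT PRINTED ∕ NOT PROVED; spine PROVED 0∕9; rung (B)+1 — the programme's
measures remain FINITE-torus statements; NOT the mass gap, NOT Clay.  HONEST DEPENDENCY: continuum YM on T⁴ ⇐ BetaPertH ∧ nine spine
estimates (0∕9 proved); BetaPertH ⇐ (D1) ∧ (D4) ∧ CAP+tail; G-an2-4 gates asym, D1 and NE2∕3∕4.
-/

set_option autoImplicit false

noncomputable section

namespace Summit.QuantumFields.BalabanUV.T4Continuum.NE7b.SupFourthCumulantPairCuts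

open MeasureTheory Real Set Function Finset
open scoped BigOperators
open SupFourthCumulantCutBounds (pair_cut_bound pairing_abs_le decay_le_min_pow)
open SupFourPointCutTree (abs_u4_le_pair_cut)

variable {ι : Type} [Fintype ι] [DecidableEq ι]
/-! ## §1. Bookkeeping -/

omit [DecidableEq ι] in
/-- `B(a,b) = B(b,a)`. [folklore] -/
theorem bilinear_symm (D : ι → ι → ℝ) (c a b : ι → ℝ) :
    ∑ w, (∑ z, D z w * a z) * (∑ z, D z w * b z) / c w = ∑ w, (∑ z, D z w * b z) * (∑ z, D z w * a z) / c w :=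
  Finset.sum_congr rfl fun w _ => by ring

omit [Fintype ι] [DecidableEq ι] in
/-- **A crossing pairing**: `|P| ≤ K∕r²⁴` with `r ≥ r_min ≥ 1` and `|P′| ≤ K∕r′²⁴` with `r′ ≥ 1` give `|P|·|P′| ≤ K²∕r_min⁶`. [folklore] -/
theorem pairing_prod_le {P P' K r r' rm : ℝ} (hK : 0 ≤ K) (hrm : 1 ≤ rm) (hr : rm ≤ r) (hr' : 1 ≤ r') (hP : |P| ≤ K / r ^ 24)
    (hP' : |P'| ≤ K / r' ^ 24) : |P| * |P'| ≤ K ^ 2 / rm ^ 6 := by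
  have h1 : |P| ≤ K / rm ^ 6 := hP.trans (decay_le_min_pow hK hrm hr)
  have h2 : |P'| ≤ K := hP'.trans (div_le_self hK (one_le_pow₀ hr'))
  have hrm0 : 0 < rm := by linarith
  calc |P| * |P'| ≤ K / rm ^ 6 * K := mul_le_mul h1 h2 (abs_nonneg _) (by positivity)
    _ = K ^ 2 / rm ^ 6 := by ring

omit [Fintype ι] [DecidableEq ι] in
/-- The same with the crossing pair second. [folklore] -/
theorem pairing_prod_le' {P P' K r r' rm : ℝ} (hK : 0 ≤ K) (hrm : 1 ≤ rm) (hr : rm ≤ r) (hr' : 1 ≤ r') (hP : |P| ≤ K / r ^ 24)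
    (hP' : |P'| ≤ K / r' ^ 24) : |P'| * |P| ≤ K ^ 2 / rm ^ 6 := by
  rw [mul_comm]; exact pairing_prod_le hK hrm hr hr' hP hP'

omit [Fintype ι] [DecidableEq ι] in
/-- `(min(r₁,r₂,r₃)²)⁻¹ ≤ max(r₁⁻², r₂⁻², r₃⁻²)`. [folklore] -/
theorem inv_min3_sq_le (r₁ r₂ r₃ : ℝ) :
    ((min r₁ (min r₂ r₃)) ^ 2)⁻¹ ≤ max (r₁ ^ 2)⁻¹ (max (r₂ ^ 2)⁻¹ (r₃ ^ 2)⁻¹) := by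
  rcases min_choice r₁ (min r₂ r₃) with h | h <;> rw [h]
  · exact le_max_left _ _
  rcases min_choice r₂ r₃ with h' | h' <;> rw [h']
  · exact (le_max_left _ _).trans (le_max_right _ _)
  · exact (le_max_right _ _).trans (le_max_right _ _)

omit [Fintype ι] [DecidableEq ι] in
/-- `(min(r₁,r₂,r₃,r₄)²)⁻¹ ≤ max(r₁⁻², r₂⁻², r₃⁻², r₄⁻²)`. [folklore] -/
theorem inv_min4_sq_le (r₁ r₂ r₃ r₄ : ℝ) :
    ((min r₁ (min r₂ (min r₃ r₄))) ^ 2)⁻¹ ≤ max (r₁ ^ 2)⁻¹ (max (r₂ ^ 2)⁻¹ (max (r₃ ^ 2)⁻¹ (r₄ ^ 2)⁻¹)) := by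
  rcases min_choice r₁ (min r₂ (min r₃ r₄)) with h | h <;> rw [h]
  · exact le_max_left _ _
  · exact (inv_min3_sq_le r₂ r₃ r₄).trans (le_max_right _ _)

omit [Fintype ι] [DecidableEq ι] in
/-- `c∕r_min⁶ ≤ C·m³` when `c ≤ C`, `C ≥ 0`, `r_min ≥ 1` and `(r_min²)⁻¹ ≤ m`. [folklore] -/
theorem div_pow_six_le {cS C rm m : ℝ} (hcC : cS ≤ C) (hC : 0 ≤ C) (hrm : 1 ≤ rm) (hm : (rm ^ 2)⁻¹ ≤ m) : cS / rm ^ 6 ≤ C * m ^ 3 := by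
  have hrm0 : 0 < rm := by linarith
  have e : C / rm ^ 6 = C * ((rm ^ 2)⁻¹) ^ 3 := by rw [inv_pow, ← pow_mul, div_eq_mul_inv]
  calc cS / rm ^ 6 ≤ C / rm ^ 6 := div_le_div_of_nonneg_right hcC (by positivity)
    _ = C * ((rm ^ 2)⁻¹) ^ 3 := e
    _ ≤ C * m ^ 3 := mul_le_mul_of_nonneg_left (pow_le_pow_left₀ (by positivity) hm 3) hC

/-! ## §2. The pair cut `{1,2}|{3,4}` -/

variable {V : (ι → ℝ) → ℝ} {V₁ : ι → (ι → ℝ) → ℝ} {c : ι → ℝ} {Cw γ : ℝ} {J D : ι → ι → ℝ}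
  {P : ι → ((ι → ℝ) → ℝ) → ((ι → ℝ) → ℝ)} {F₁ F₂ F₃ F₄ : (ι → ℝ) → ℝ} {a₁ a₂ a₃ a₄ : ι → ℝ}

/-- **CUT `{1,2}|{3,4}`**: `|u₄| ≤ C·max(q₁₃,q₁₄,q₂₃,q₂₄)³`. [folklore] -/
theorem cut_one_two (hP : ∀ x F ω, P x F ω = (∫ s, F (update ω x s) * exp (-V (update ω x s))) / ∫ s, exp (-V (update ω x s)))
    (hV : ∀ x ω, HasDerivAt (fun s => V (update ω x s)) (V₁ x ω) (ω x))
    (hfloor : ∀ x ω s t, c x * (s - t) ^ 2 ≤ (V₁ x (update ω x s) - V₁ x (update ω x t)) * (s - t)) (hc : ∀ x, 0 < c x)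
    (hceil : ∀ x ω s t, |V₁ x (update ω x s) - V₁ x (update ω x t)| ≤ Cw * |s - t|)
    (hcross : ∀ x z, z ≠ x → ∀ ω s t, |V₁ x (update ω z s) - V₁ x (update ω z t)| ≤ J x z * |s - t|) (hVc : Continuous V)
    (hV0 : Integrable (fun ω : ι → ℝ => exp (-V ω))) (hV2 : ∀ z, Integrable (fun ω : ι → ℝ => ω z ^ 2 * exp (-V ω)))
    (hJ : ∀ x z, 0 ≤ J x z) (hJ0 : ∀ x, J x x = 0) (hrow : ∀ x, ∑ z, J x z / c x ≤ γ) (hγ0 : 0 ≤ γ) (hγ1 : γ < 1)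
    (hD : ∀ x y, 0 ≤ D x y) (hDC : ∀ x y, (if x = y then (1 : ℝ) else 0) + ∑ z, D x z * (J z y / c z) ≤ D x y)
    (h1 : ∀ z ω s t, |F₁ (update ω z s) - F₁ (update ω z t)| ≤ a₁ z * |s - t|) (h2 : ∀ z ω s t, |F₂ (update ω z s) - F₂ (update ω z t)| ≤ a₂ z * |s -
        t|)
    (h3 : ∀ z ω s t, |F₃ (update ω z s) - F₃ (update ω z t)| ≤ a₃ z * |s - t|) (h4 : ∀ z ω s t, |F₄ (update ω z s) - F₄ (update ω z t)| ≤ a₄ z * |s -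
        t|)
    {K r13 r14 r23 r24 M₂ M₄ M₆ : ℝ} (hK : 0 ≤ K) (hr13 : 1 ≤ r13) (hr14 : 1 ≤ r14) (hr23 : 1 ≤ r23) (hr24 : 1 ≤ r24)
    (hB13 : (∑ w, (∑ z, D z w * a₁ z) * (∑ z, D z w * a₃ z) / c w) ≤ K / r13 ^ 24)
    (hB14 : (∑ w, (∑ z, D z w * a₁ z) * (∑ z, D z w * a₄ z) / c w) ≤ K / r14 ^ 24)
    (hB23 : (∑ w, (∑ z, D z w * a₂ z) * (∑ z, D z w * a₃ z) / c w) ≤ K / r23 ^ 24)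
    (hB24 : (∑ w, (∑ z, D z w * a₂ z) * (∑ z, D z w * a₄ z) / c w) ≤ K / r24 ^ 24)
    (hq1 : Integrable (fun ω => (F₁ ω - (∫ ω', F₁ ω' ∂((volume : Measure (ι → ℝ)).tilted fun ω => -V ω))) ^ 4) ((volume : Measure (ι → ℝ)).tilted fun
        ω => -V ω)) (hs1 : Integrable (fun ω => (F₁ ω - (∫ ω', F₁ ω' ∂((volume : Measure (ι → ℝ)).tilted fun ω => -V ω))) ^ 6) ((volume : Measure (ι
        → ℝ)).tilted fun ω => -V ω))
    (hM21 : ∫ ω, (F₁ ω - (∫ ω', F₁ ω' ∂((volume : Measure (ι → ℝ)).tilted fun ω => -V ω))) ^ 2 ∂((volume : Measure (ι → ℝ)).tilted fun ω => -V ω) ≤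
        M₂) (hM41 : ∫ ω, (F₁ ω - (∫ ω', F₁ ω' ∂((volume : Measure (ι → ℝ)).tilted fun ω => -V ω))) ^ 4 ∂((volume : Measure (ι → ℝ)).tilted fun ω =>
        -V ω) ≤ M₄)
    (hM61 : ∫ ω, (F₁ ω - (∫ ω', F₁ ω' ∂((volume : Measure (ι → ℝ)).tilted fun ω => -V ω))) ^ 6 ∂((volume : Measure (ι → ℝ)).tilted fun ω => -V ω) ≤
        M₆)
    (hq2 : Integrable (fun ω => (F₂ ω - (∫ ω', F₂ ω' ∂((volume : Measure (ι → ℝ)).tilted fun ω => -V ω))) ^ 4) ((volume : Measure (ι → ℝ)).tilted fun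
        ω => -V ω)) (hs2 : Integrable (fun ω => (F₂ ω - (∫ ω', F₂ ω' ∂((volume : Measure (ι → ℝ)).tilted fun ω => -V ω))) ^ 6) ((volume : Measure (ι
        → ℝ)).tilted fun ω => -V ω))
    (hM22 : ∫ ω, (F₂ ω - (∫ ω', F₂ ω' ∂((volume : Measure (ι → ℝ)).tilted fun ω => -V ω))) ^ 2 ∂((volume : Measure (ι → ℝ)).tilted fun ω => -V ω) ≤
        M₂) (hM42 : ∫ ω, (F₂ ω - (∫ ω', F₂ ω' ∂((volume : Measure (ι → ℝ)).tilted fun ω => -V ω))) ^ 4 ∂((volume : Measure (ι → ℝ)).tilted fun ω =>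
        -V ω) ≤ M₄)
    (hM62 : ∫ ω, (F₂ ω - (∫ ω', F₂ ω' ∂((volume : Measure (ι → ℝ)).tilted fun ω => -V ω))) ^ 6 ∂((volume : Measure (ι → ℝ)).tilted fun ω => -V ω) ≤
        M₆)
    (hq3 : Integrable (fun ω => (F₃ ω - (∫ ω', F₃ ω' ∂((volume : Measure (ι → ℝ)).tilted fun ω => -V ω))) ^ 4) ((volume : Measure (ι → ℝ)).tilted fun
        ω => -V ω)) (hs3 : Integrable (fun ω => (F₃ ω - (∫ ω', F₃ ω' ∂((volume : Measure (ι → ℝ)).tilted fun ω => -V ω))) ^ 6) ((volume : Measure (ι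
        → ℝ)).tilted fun ω => -V ω))
    (hM23 : ∫ ω, (F₃ ω - (∫ ω', F₃ ω' ∂((volume : Measure (ι → ℝ)).tilted fun ω => -V ω))) ^ 2 ∂((volume : Measure (ι → ℝ)).tilted fun ω => -V ω) ≤
        M₂) (hM43 : ∫ ω, (F₃ ω - (∫ ω', F₃ ω' ∂((volume : Measure (ι → ℝ)).tilted fun ω => -V ω))) ^ 4 ∂((volume : Measure (ι → ℝ)).tilted fun ω =>
        -V ω) ≤ M₄)
    (hM63 : ∫ ω, (F₃ ω - (∫ ω', F₃ ω' ∂((volume : Measure (ι → ℝ)).tilted fun ω => -V ω))) ^ 6 ∂((volume : Measure (ι → ℝ)).tilted fun ω => -V ω) ≤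
        M₆)
    (hq4 : Integrable (fun ω => (F₄ ω - (∫ ω', F₄ ω' ∂((volume : Measure (ι → ℝ)).tilted fun ω => -V ω))) ^ 4) ((volume : Measure (ι → ℝ)).tilted fun
        ω => -V ω)) (hs4 : Integrable (fun ω => (F₄ ω - (∫ ω', F₄ ω' ∂((volume : Measure (ι → ℝ)).tilted fun ω => -V ω))) ^ 6) ((volume : Measure (ι
        → ℝ)).tilted fun ω => -V ω))
    (hM24 : ∫ ω, (F₄ ω - (∫ ω', F₄ ω' ∂((volume : Measure (ι → ℝ)).tilted fun ω => -V ω))) ^ 2 ∂((volume : Measure (ι → ℝ)).tilted fun ω => -V ω) ≤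
        M₂) (hM44 : ∫ ω, (F₄ ω - (∫ ω', F₄ ω' ∂((volume : Measure (ι → ℝ)).tilted fun ω => -V ω))) ^ 4 ∂((volume : Measure (ι → ℝ)).tilted fun ω =>
        -V ω) ≤ M₄)
    (hM64 : ∫ ω, (F₄ ω - (∫ ω', F₄ ω' ∂((volume : Measure (ι → ℝ)).tilted fun ω => -V ω))) ^ 6 ∂((volume : Measure (ι → ℝ)).tilted fun ω => -V ω) ≤
        M₆) :
    |(∫ ω, (F₁ ω - (∫ ω', F₁ ω' ∂((volume : Measure (ι → ℝ)).tilted fun ω => -V ω))) * (F₂ ω - (∫ ω', F₂ ω' ∂((volume : Measure (ι → ℝ)).tilted fun ω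
        => -V ω))) * (F₃ ω - (∫ ω', F₃ ω' ∂((volume : Measure (ι → ℝ)).tilted fun ω => -V ω))) * (F₄ ω - (∫ ω', F₄ ω' ∂((volume : Measure (ι →
        ℝ)).tilted fun ω => -V ω))) ∂((volume : Measure (ι → ℝ)).tilted fun ω => -V ω)) - (∫ ω, (F₁ ω - (∫ ω', F₁ ω' ∂((volume : Measure (ι →
        ℝ)).tilted fun ω => -V ω))) * (F₂ ω - (∫ ω', F₂ ω' ∂((volume : Measure (ι → ℝ)).tilted fun ω => -V ω))) ∂((volume : Measure (ι → ℝ)).tilted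
        fun ω => -V ω)) * (∫ ω, (F₃ ω - (∫ ω', F₃ ω' ∂((volume : Measure (ι → ℝ)).tilted fun ω => -V ω))) * (F₄ ω - (∫ ω', F₄ ω' ∂((volume : Measure
        (ι → ℝ)).tilted fun ω => -V ω))) ∂((volume : Measure (ι → ℝ)).tilted fun ω => -V ω)) - (∫ ω, (F₁ ω - (∫ ω', F₁ ω' ∂((volume : Measure (ι →
        ℝ)).tilted fun ω => -V ω))) * (F₃ ω - (∫ ω', F₃ ω' ∂((volume : Measure (ι → ℝ)).tilted fun ω => -V ω))) ∂((volume : Measure (ι → ℝ)).tilted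
        fun ω => -V ω)) * (∫ ω, (F₂ ω - (∫ ω', F₂ ω' ∂((volume : Measure (ι → ℝ)).tilted fun ω => -V ω))) * (F₄ ω - (∫ ω', F₄ ω' ∂((volume : Measure
        (ι → ℝ)).tilted fun ω => -V ω))) ∂((volume : Measure (ι → ℝ)).tilted fun ω => -V ω)) - (∫ ω, (F₁ ω - (∫ ω', F₁ ω' ∂((volume : Measure (ι →
        ℝ)).tilted fun ω => -V ω))) * (F₄ ω - (∫ ω', F₄ ω' ∂((volume : Measure (ι → ℝ)).tilted fun ω => -V ω))) ∂((volume : Measure (ι → ℝ)).tilted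
        fun ω => -V ω)) * (∫ ω, (F₂ ω - (∫ ω', F₂ ω' ∂((volume : Measure (ι → ℝ)).tilted fun ω => -V ω))) * (F₃ ω - (∫ ω', F₃ ω' ∂((volume : Measure
        (ι → ℝ)).tilted fun ω => -V ω))) ∂((volume : Measure (ι → ℝ)).tilted fun ω => -V ω))| ≤
      (4 * K + 3 * K ^ 2 + 4 * M₄ + 4 * M₆ + 2 * M₂ * (M₂ + M₄)) * (max (r13 ^ 2)⁻¹ (max (r14 ^ 2)⁻¹ (max (r23 ^ 2)⁻¹ (r24 ^ 2)⁻¹))) ^ 3 := by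
  have hM2 : 0 ≤ M₂ := le_trans (integral_nonneg fun ω => sq_nonneg _) hM21
  have hM4 : 0 ≤ M₄ := le_trans (integral_nonneg fun ω => by positivity) hM41
  have hM6 : 0 ≤ M₆ := le_trans (integral_nonneg fun ω => by positivity) hM61
  have hC : 0 ≤ (4 * K + 3 * K ^ 2 + 4 * M₄ + 4 * M₆ + 2 * M₂ * (M₂ + M₄)) := by positivity
  have hcP : 4 * K + (2 * M₄ + 2 * M₆ + 2 * M₂ * (M₂ + M₄)) + K ^ 2 + K ^ 2 ≤ (4 * K + 3 * K ^ 2 + 4 * M₄ + 4 * M₆ + 2 * M₂ * (M₂ + M₄)) := by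
      nlinarith
  have p13 := pairing_abs_le hP hV hfloor hc hceil hcross hVc hV0 hV2 hJ hJ0 hrow hγ0 hγ1 hD hDC h1 h3 hB13
  have p24 := pairing_abs_le hP hV hfloor hc hceil hcross hVc hV0 hV2 hJ hJ0 hrow hγ0 hγ1 hD hDC h2 h4 hB24
  have p14 := pairing_abs_le hP hV hfloor hc hceil hcross hVc hV0 hV2 hJ hJ0 hrow hγ0 hγ1 hD hDC h1 h4 hB14
  have p23 := pairing_abs_le hP hV hfloor hc hceil hcross hVc hV0 hV2 hJ hJ0 hrow hγ0 hγ1 hD hDC h2 h3 hB23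
  have hcut := pair_cut_bound hP hV hfloor hc hceil hcross hVc hV0 hV2 hJ hJ0 hrow hγ0 hγ1 hD hDC h1 h2 h3 h4 hK hr13 hr14 hr23 hr24 hB13 hB14 hB23
      hB24 hq1 hs1 hM21 hM41 hM61 hq2 hs2 hM22 hM42 hM62 hq3 hs3 hM23 hM43 hM63 hq4 hs4 hM24 hM44 hM64
  set rmv : ℝ := min r13 (min r14 (min r23 r24)) with hrmv
  have hrm : 1 ≤ rmv := le_min hr13 (le_min hr14 (le_min hr23 hr24))
  have q1 := pairing_prod_le hK hrm (min_le_left _ _) hr24 p13 p24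
  have q2 := pairing_prod_le hK hrm ((min_le_right _ _).trans (min_le_left _ _)) hr23 p14 p23
  refine (abs_u4_le_pair_cut (∫ ω, (F₁ ω - (∫ ω', F₁ ω' ∂((volume : Measure (ι → ℝ)).tilted fun ω => -V ω))) * (F₂ ω - (∫ ω', F₂ ω' ∂((volume :
      Measure (ι → ℝ)).tilted fun ω => -V ω))) * (F₃ ω - (∫ ω', F₃ ω' ∂((volume : Measure (ι → ℝ)).tilted fun ω => -V ω))) * (F₄ ω - (∫ ω', F₄ ω'
      ∂((volume : Measure (ι → ℝ)).tilted fun ω => -V ω))) ∂((volume : Measure (ι → ℝ)).tilted fun ω => -V ω)) (∫ ω, (F₁ ω - (∫ ω', F₁ ω' ∂((volume :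
      Measure (ι → ℝ)).tilted fun ω => -V ω))) * (F₂ ω - (∫ ω', F₂ ω' ∂((volume : Measure (ι → ℝ)).tilted fun ω => -V ω))) ∂((volume : Measure (ι →
      ℝ)).tilted fun ω => -V ω)) (∫ ω, (F₃ ω - (∫ ω', F₃ ω' ∂((volume : Measure (ι → ℝ)).tilted fun ω => -V ω))) * (F₄ ω - (∫ ω', F₄ ω' ∂((volume :
      Measure (ι → ℝ)).tilted fun ω => -V ω))) ∂((volume : Measure (ι → ℝ)).tilted fun ω => -V ω)) (∫ ω, (F₁ ω - (∫ ω', F₁ ω' ∂((volume : Measure (ι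
      → ℝ)).tilted fun ω => -V ω))) * (F₃ ω - (∫ ω', F₃ ω' ∂((volume : Measure (ι → ℝ)).tilted fun ω => -V ω))) ∂((volume : Measure (ι → ℝ)).tilted
      fun ω => -V ω)) (∫ ω, (F₂ ω - (∫ ω', F₂ ω' ∂((volume : Measure (ι → ℝ)).tilted fun ω => -V ω))) * (F₄ ω - (∫ ω', F₄ ω' ∂((volume : Measure (ι →
      ℝ)).tilted fun ω => -V ω))) ∂((volume : Measure (ι → ℝ)).tilted fun ω => -V ω)) (∫ ω, (F₁ ω - (∫ ω', F₁ ω' ∂((volume : Measure (ι → ℝ)).tilted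
      fun ω => -V ω))) * (F₄ ω - (∫ ω', F₄ ω' ∂((volume : Measure (ι → ℝ)).tilted fun ω => -V ω))) ∂((volume : Measure (ι → ℝ)).tilted fun ω => -V
      ω)) (∫ ω, (F₂ ω - (∫ ω', F₂ ω' ∂((volume : Measure (ι → ℝ)).tilted fun ω => -V ω))) * (F₃ ω - (∫ ω', F₃ ω' ∂((volume : Measure (ι → ℝ)).tilted
      fun ω => -V ω))) ∂((volume : Measure (ι → ℝ)).tilted fun ω => -V ω))).trans ?_
  refine le_trans ?_ (div_pow_six_le hcP hC hrm (inv_min4_sq_le r13 r14 r23 r24))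
  have hsum : (4 * K + (2 * M₄ + 2 * M₆ + 2 * M₂ * (M₂ + M₄))) / rmv ^ 6 + K ^ 2 / rmv ^ 6 + K ^ 2 / rmv ^ 6 =
      (4 * K + (2 * M₄ + 2 * M₆ + 2 * M₂ * (M₂ + M₄)) + K ^ 2 + K ^ 2) / rmv ^ 6 := by ring
  linarith [hcut, q1, q2]
end Summit.QuantumFields.BalabanUV.T4Continuum.NE7b.SupFourthCumulantPairCuts

end
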